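import Summits.KontsevichZagierPeriods.KontsevichZagierPeriods.Theorems.HurwitzMicroSectorsNormalFormPrincipleM4SimplexFacts
import Summits.KontsevichZagierPeriods.KontsevichZagierPeriods.Theorems.HurwitzMicroSectorsNormalFormPrincipleL2W3ExistsWordRep

/-!
# `NormalFormPrinciple` (stmt-KontsevichZagierPeriods-3869), line `SketchIdeator1` —
# leaf `stub_boxRigidity`, layer `M4` toolkit: the word carriers of dimension four exist

Pure proof file (stub `m4_exists_wordRep4`, a registered sub-goal of
stmt-KontsevichZagierPeriods-3869, line `SketchIdeator1`, lead seat c9; layer `M4` toolkit — the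
dimension-four campaign of the leaf `stub_boxRigidity`; `--supports` the crux). The generic moves
of the campaign act on *word representations* `[Δ₄, x(t₀)·y(t₁)·z(t₂)·w(t₃)]` on the decreasing
open simplex `Δ₄ = {t | 0 < t₃ < t₂ < t₁ < t₀ < 1} ⊆ ℝ⁴` (the iterated integral
`∫_{1 > t₀ > t₁ > t₂ > t₃ > 0} x y z w`, outermost letter first), the letters being the three
logarithmic forms of level two, `a u = 1/u`, `b u = 1/(1−u)`, `c u = 1/(1+u)`, with the usual
convergence constraint: the first letter is not `b` and the last letter is not `a`.

This file supplies the EXISTENCE of these `2·3·3·2 = 36` carriers as honest integral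
representations (`Literature.NumberTheory.Transcendental.KZ.IntegralRep 4`) with literally this
domain and the integrand `t ↦ x (t 0) * y (t 1) * z (t 2) * w (t 3)`, uniformly in the letters:
`Δ₄` is Kontsevich's open ordered simplex (`ℚ`-semialgebraic and measurable, shared facts file of
the layer); each letter evaluated at a coordinate is the reciprocal of a `ℚ`-polynomial which does
not vanish on `Δ₄` (all coordinates lie in `(0,1)`), so the integrand is a product of
`ℚ`-semialgebraic functions, continuous on `Δ₄`; and on `(0,1)` one has `|x u| ≤ 1/u` for
`x ∈ {a, c}`, `|y u| ≤ 1/u + 1/(1−u)` for every letter, `|w u| ≤ 1/(1−u)` for `w ∈ {b, c}`, whence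
the domination of `|x(t₀) y(t₁) z(t₂) w(t₃)|` by
`(1/t₀)(1/t₁ + 1/(1−t₁))(1/t₂ + 1/(1−t₂))(1/(1−t₃))`, the sum of the integrands of Kontsevich's
absolutely convergent iterated integrals for `ζ(4)`, `ζ(3,1)`, `ζ(2,2)`, `ζ(2,1,1)`
(`KZ.mzvIntegrand_integrableOn_holds`). No move of the Kontsevich–Zagier calculus (rules 1a, 1b,
2, 3) is performed here; the packaging is `m4s_exists_rep_of_abs_le` of the shared facts file.

References: M. Kontsevich, D. Zagier, *Periods* (2001), §1.1–1.2; D. Zagier, *Values of zeta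
functions and their applications* (1994), §9. No definitions are introduced.
-/

noncomputable section

open MeasureTheory Set
open Literature.NumberTheory.Transcendental Literature.NumberTheory.Transcendental.KZ
open Literature.ModelTheory.ExponentialFields (IsSemialgebraic)

namespace Summit.KontsevichZagierPeriods.HurwitzMicroSectors.NormalFormPrinciple.PiBox.M3

/-! ## The letters on the decreasing open simplex `Δ₄ = {0 < t₃ < t₂ < t₁ < t₀ < 1}` -/

/-- The letter `a u = 1/u` at any coordinate is continuous and `ℚ`-semialgebraic on `Δ₄`
(reciprocal of a non-vanishing `ℚ`-polynomial). [folklore] -/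
theorem m4w_letter_a (i : Fin 4) :
    ContinuousOn (fun t : Fin 4 → ℝ => 1 / t i)
        {t : Fin 4 → ℝ | 0 < t 3 ∧ t 3 < t 2 ∧ t 2 < t 1 ∧ t 1 < t 0 ∧ t 0 < 1} ∧
      IsSemialgebraicFunOn ℚ
        {t : Fin 4 → ℝ | 0 < t 3 ∧ t 3 < t 2 ∧ t 2 < t 1 ∧ t 1 < t 0 ∧ t 0 < 1}
        (fun t => 1 / t i) := by
  have hne : ∀ t ∈ {t : Fin 4 → ℝ | 0 < t 3 ∧ t 3 < t 2 ∧ t 2 < t 1 ∧ t 1 < t 0 ∧ t 0 < 1},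
      t i ≠ 0 :=
    fun t ht => (m4s_mem_Ioo_of_mem_simplex4 ht i).1.ne'
  refine ⟨continuousOn_const.div (continuous_apply i).continuousOn hne, ?_⟩
  refine (isSemialgebraicFunOn_aeval_div_aeval m4s_isSemialgebraic_simplex4
    (1 : MvPolynomial (Fin 4) ℚ) (MvPolynomial.X i) fun t ht => ?_).congr fun t _ => ?_
  · rw [MvPolynomial.aeval_X]
    exact hne t ht
  · simp only [map_one, MvPolynomial.aeval_X]

/-- The letter `b u = 1/(1−u)` at any coordinate is continuous and `ℚ`-semialgebraic on `Δ₄`.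
[folklore] -/
theorem m4w_letter_b (i : Fin 4) :
    ContinuousOn (fun t : Fin 4 → ℝ => 1 / (1 - t i))
        {t : Fin 4 → ℝ | 0 < t 3 ∧ t 3 < t 2 ∧ t 2 < t 1 ∧ t 1 < t 0 ∧ t 0 < 1} ∧
      IsSemialgebraicFunOn ℚ
        {t : Fin 4 → ℝ | 0 < t 3 ∧ t 3 < t 2 ∧ t 2 < t 1 ∧ t 1 < t 0 ∧ t 0 < 1}
        (fun t => 1 / (1 - t i)) := by
  have hne : ∀ t ∈ {t : Fin 4 → ℝ | 0 < t 3 ∧ t 3 < t 2 ∧ t 2 < t 1 ∧ t 1 < t 0 ∧ t 0 < 1},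
      1 - t i ≠ 0 :=
    fun t ht => (sub_pos.2 (m4s_mem_Ioo_of_mem_simplex4 ht i).2).ne'
  refine ⟨continuousOn_const.div (continuousOn_const.sub (continuous_apply i).continuousOn) hne,
    ?_⟩
  refine (isSemialgebraicFunOn_aeval_div_aeval m4s_isSemialgebraic_simplex4
    (1 : MvPolynomial (Fin 4) ℚ) (1 - MvPolynomial.X i) fun t ht => ?_).congr fun t _ => ?_
  · rw [map_sub, map_one, MvPolynomial.aeval_X]
    exact hne t ht
  · simp only [map_sub, map_one, MvPolynomial.aeval_X]

/-- The letter `c u = 1/(1+u)` at any coordinate is continuous and `ℚ`-semialgebraic on `Δ₄`.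
[folklore] -/
theorem m4w_letter_c (i : Fin 4) :
    ContinuousOn (fun t : Fin 4 → ℝ => 1 / (1 + t i))
        {t : Fin 4 → ℝ | 0 < t 3 ∧ t 3 < t 2 ∧ t 2 < t 1 ∧ t 1 < t 0 ∧ t 0 < 1} ∧
      IsSemialgebraicFunOn ℚ
        {t : Fin 4 → ℝ | 0 < t 3 ∧ t 3 < t 2 ∧ t 2 < t 1 ∧ t 1 < t 0 ∧ t 0 < 1}
        (fun t => 1 / (1 + t i)) := by
  have hne : ∀ t ∈ {t : Fin 4 → ℝ | 0 < t 3 ∧ t 3 < t 2 ∧ t 2 < t 1 ∧ t 1 < t 0 ∧ t 0 < 1},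
      1 + t i ≠ 0 :=
    fun t ht => (add_pos one_pos (m4s_mem_Ioo_of_mem_simplex4 ht i).1).ne'
  refine ⟨continuousOn_const.div (continuousOn_const.add (continuous_apply i).continuousOn) hne,
    ?_⟩
  refine (isSemialgebraicFunOn_aeval_div_aeval m4s_isSemialgebraic_simplex4
    (1 : MvPolynomial (Fin 4) ℚ) (1 + MvPolynomial.X i) fun t ht => ?_).congr fun t _ => ?_
  · rw [map_add, map_one, MvPolynomial.aeval_X]
    exact hne t ht
  · simp only [map_add, map_one, MvPolynomial.aeval_X]

/-! ## Letter classes: first, middle, last -/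

/-- **First letters** `x ∈ {a, c}` (regular at `u = 1`): continuous and `ℚ`-semialgebraic at
every coordinate of `Δ₄`, and `|x u| ≤ 1/u` on `(0,1)`. [folklore] -/
theorem m4w_first {x : ℝ → ℝ}
    (hx : x ∈ ({fun u => 1 / u, fun u => 1 / (1 + u)} : Set (ℝ → ℝ))) :
    (∀ i : Fin 4,
      ContinuousOn (fun t : Fin 4 → ℝ => x (t i))
          {t : Fin 4 → ℝ | 0 < t 3 ∧ t 3 < t 2 ∧ t 2 < t 1 ∧ t 1 < t 0 ∧ t 0 < 1} ∧
        IsSemialgebraicFunOn ℚ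
          {t : Fin 4 → ℝ | 0 < t 3 ∧ t 3 < t 2 ∧ t 2 < t 1 ∧ t 1 < t 0 ∧ t 0 < 1}
          (fun t => x (t i))) ∧
    ∀ u : ℝ, 0 < u → u < 1 → |x u| ≤ 1 / u := by
  rcases hx with rfl | rfl
  · exact ⟨m4w_letter_a, fun u hu _ => l2a_abs_one_div_le hu le_rfl⟩
  · exact ⟨m4w_letter_c, fun u hu _ => l2a_abs_one_div_le hu (by linarith : u ≤ 1 + u)⟩

/-- **Middle letters** `y ∈ {a, b, c}`: continuous and `ℚ`-semialgebraic at every coordinate of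
`Δ₄`, and `|y u| ≤ 1/u + 1/(1−u)` on `(0,1)`. [folklore] -/
theorem m4w_middle {y : ℝ → ℝ}
    (hy : y ∈ ({fun u => 1 / u, fun u => 1 / (1 - u), fun u => 1 / (1 + u)} : Set (ℝ → ℝ))) :
    (∀ i : Fin 4,
      ContinuousOn (fun t : Fin 4 → ℝ => y (t i))
          {t : Fin 4 → ℝ | 0 < t 3 ∧ t 3 < t 2 ∧ t 2 < t 1 ∧ t 1 < t 0 ∧ t 0 < 1} ∧
        IsSemialgebraicFunOn ℚ
          {t : Fin 4 → ℝ | 0 < t 3 ∧ t 3 < t 2 ∧ t 2 < t 1 ∧ t 1 < t 0 ∧ t 0 < 1}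
          (fun t => y (t i))) ∧
    ∀ u : ℝ, 0 < u → u < 1 → |y u| ≤ 1 / u + 1 / (1 - u) := by
  rcases hy with rfl | rfl | rfl
  · exact ⟨m4w_letter_a, fun u hu hu1 => (l2a_abs_one_div_le hu le_rfl).trans
      (le_add_of_nonneg_right (one_div_pos.2 (sub_pos.2 hu1)).le)⟩
  · exact ⟨m4w_letter_b, fun u hu hu1 => (l2a_abs_one_div_le (sub_pos.2 hu1) le_rfl).trans
      (le_add_of_nonneg_left (one_div_pos.2 hu).le)⟩
  · exact ⟨m4w_letter_c, fun u hu hu1 =>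
      (l2a_abs_one_div_le hu (by linarith : u ≤ 1 + u)).trans
        (le_add_of_nonneg_right (one_div_pos.2 (sub_pos.2 hu1)).le)⟩

/-- **Last letters** `w ∈ {b, c}` (regular at `u = 0`): continuous and `ℚ`-semialgebraic at every
coordinate of `Δ₄`, and `|w u| ≤ 1/(1−u)` on `(0,1)`. [folklore] -/
theorem m4w_last {w : ℝ → ℝ}
    (hw : w ∈ ({fun u => 1 / (1 - u), fun u => 1 / (1 + u)} : Set (ℝ → ℝ))) :
    (∀ i : Fin 4,
      ContinuousOn (fun t : Fin 4 → ℝ => w (t i))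
          {t : Fin 4 → ℝ | 0 < t 3 ∧ t 3 < t 2 ∧ t 2 < t 1 ∧ t 1 < t 0 ∧ t 0 < 1} ∧
        IsSemialgebraicFunOn ℚ
          {t : Fin 4 → ℝ | 0 < t 3 ∧ t 3 < t 2 ∧ t 2 < t 1 ∧ t 1 < t 0 ∧ t 0 < 1}
          (fun t => w (t i))) ∧
    ∀ u : ℝ, 0 < u → u < 1 → |w u| ≤ 1 / (1 - u) := by
  rcases hw with rfl | rfl
  · exact ⟨m4w_letter_b, fun u _ hu1 => l2a_abs_one_div_le (sub_pos.2 hu1) le_rfl⟩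
  · exact ⟨m4w_letter_c, fun u hu hu1 =>
      l2a_abs_one_div_le (sub_pos.2 hu1) (by linarith : 1 - u ≤ 1 + u)⟩

/-! ## Absolute convergence: domination by `ζ(4) + ζ(3,1) + ζ(2,2) + ζ(2,1,1)` -/

/-- The sum of the integrands of Kontsevich's formula for `ζ(4)`, `ζ(3,1)`, `ζ(2,2)`, `ζ(2,1,1)`
(words `0001`, `0011`, `0101`, `0111`) factors as
`ω₀(t₀) (ω₀ + ω₁)(t₁) (ω₀ + ω₁)(t₂) ω₁(t₃)`. [folklore] -/
theorem m4w_mzvIntegrand_sum (t : Fin 4 → ℝ) :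
    mzvIntegrand [4] t + mzvIntegrand [3, 1] t + mzvIntegrand [2, 2] t + mzvIntegrand [2, 1, 1] t =
      1 / t 0 * (1 / t 1 + 1 / (1 - t 1)) * (1 / t 2 + 1 / (1 - t 2)) * (1 / (1 - t 3)) := by
  -- adapted from Cruxes/StuffleInKZ/Disproof.lean `mzvIntegrand_four`, `mzvIntegrand_three_one`
  have e4 : mzvIntegrand [4] t = 1 / t 0 * (1 / t 1) * (1 / t 2) * (1 / (1 - t 3)) := by
    show (∏ i : Fin 4, mzvForm ([false, false, false, true].getD i false) (t i)) = _
    rw [Fin.prod_univ_four]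
    rfl
  have e31 : mzvIntegrand [3, 1] t = 1 / t 0 * (1 / t 1) * (1 / (1 - t 2)) * (1 / (1 - t 3)) := by
    show (∏ i : Fin 4, mzvForm ([false, false, true, true].getD i false) (t i)) = _
    rw [Fin.prod_univ_four]
    rfl
  have e22 : mzvIntegrand [2, 2] t = 1 / t 0 * (1 / (1 - t 1)) * (1 / t 2) * (1 / (1 - t 3)) := by
    show (∏ i : Fin 4, mzvForm ([false, true, false, true].getD i false) (t i)) = _
    rw [Fin.prod_univ_four]
    rfl
  have e211 :
      mzvIntegrand [2, 1, 1] t = 1 / t 0 * (1 / (1 - t 1)) * (1 / (1 - t 2)) * (1 / (1 - t 3)) := by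
    show (∏ i : Fin 4, mzvForm ([false, true, true, true].getD i false) (t i)) = _
    rw [Fin.prod_univ_four]
    rfl
  rw [e4, e31, e22, e211]
  ring

/-- **The dominator is integrable on `Δ₄`**: `(1/t₀)(1/t₁ + 1/(1−t₁))(1/t₂ + 1/(1−t₂))(1/(1−t₃))`
is the sum of the integrands of Kontsevich's absolutely convergent iterated integrals for `ζ(4)`,
`ζ(3,1)`, `ζ(2,2)`, `ζ(2,1,1)` on the open ordered simplex `Δ₄ = KZ.openOrderedSimplex 4`
(`KZ.mzvIntegrand_integrableOn_holds`). [folklore] -/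
theorem m4w_integrableOn_dominator :
    IntegrableOn (fun t : Fin 4 → ℝ =>
        1 / t 0 * (1 / t 1 + 1 / (1 - t 1)) * (1 / t 2 + 1 / (1 - t 2)) * (1 / (1 - t 3)))
      {t : Fin 4 → ℝ | 0 < t 3 ∧ t 3 < t 2 ∧ t 2 < t 1 ∧ t 1 < t 0 ∧ t 0 < 1} := by
  have h4 : IntegrableOn (fun t : Fin 4 → ℝ => mzvIntegrand [4] t) (openOrderedSimplex 4) volume :=
    mzvIntegrand_integrableOn_holds [4] (by decide)
  have h31 : IntegrableOn (fun t : Fin 4 → ℝ => mzvIntegrand [3, 1] t) (openOrderedSimplex 4)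
      volume :=
    mzvIntegrand_integrableOn_holds [3, 1] (by decide)
  have h22 : IntegrableOn (fun t : Fin 4 → ℝ => mzvIntegrand [2, 2] t) (openOrderedSimplex 4)
      volume :=
    mzvIntegrand_integrableOn_holds [2, 2] (by decide)
  have h211 : IntegrableOn (fun t : Fin 4 → ℝ => mzvIntegrand [2, 1, 1] t) (openOrderedSimplex 4)
      volume :=
    mzvIntegrand_integrableOn_holds [2, 1, 1] (by decide)
  have hsum : IntegrableOn (fun t : Fin 4 → ℝ => mzvIntegrand [4] t + mzvIntegrand [3, 1] t +
      mzvIntegrand [2, 2] t + mzvIntegrand [2, 1, 1] t) (openOrderedSimplex 4) volume :=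
    ((h4.add h31).add h22).add h211
  rw [m4s_simplex4_eq_openOrderedSimplex]
  exact hsum.congr_fun (fun t _ => m4w_mzvIntegrand_sum t) (measurableSet_openOrderedSimplex 4)

/-- **Domination of a word integrand of dimension four.** If `|x u| ≤ 1/u`,
`|y u|, |z u| ≤ 1/u + 1/(1−u)` and `|w u| ≤ 1/(1−u)` on `(0,1)`, then on `Δ₄`
`|x(t₀) y(t₁) z(t₂) w(t₃)| ≤ (1/t₀)(1/t₁ + 1/(1−t₁))(1/t₂ + 1/(1−t₂))(1/(1−t₃))`. [folklore] -/
theorem m4w_abs_word_le {x y z w : ℝ → ℝ}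
    (hxb : ∀ u : ℝ, 0 < u → u < 1 → |x u| ≤ 1 / u)
    (hyb : ∀ u : ℝ, 0 < u → u < 1 → |y u| ≤ 1 / u + 1 / (1 - u))
    (hzb : ∀ u : ℝ, 0 < u → u < 1 → |z u| ≤ 1 / u + 1 / (1 - u))
    (hwb : ∀ u : ℝ, 0 < u → u < 1 → |w u| ≤ 1 / (1 - u)) :
    ∀ t ∈ {t : Fin 4 → ℝ | 0 < t 3 ∧ t 3 < t 2 ∧ t 2 < t 1 ∧ t 1 < t 0 ∧ t 0 < 1},
      |x (t 0) * y (t 1) * z (t 2) * w (t 3)| ≤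
        1 / t 0 * (1 / t 1 + 1 / (1 - t 1)) * (1 / t 2 + 1 / (1 - t 2)) * (1 / (1 - t 3)) := by
  intro t ht
  have hc := m4s_mem_Ioo_of_mem_simplex4 ht
  have h0 : 0 < t 0 := (hc 0).1
  have h1 : 0 < t 1 := (hc 1).1
  have h1' : 0 < 1 - t 1 := sub_pos.2 (hc 1).2
  have h2 : 0 < t 2 := (hc 2).1
  have h2' : 0 < 1 - t 2 := sub_pos.2 (hc 2).2
  have hx' := hxb (t 0) h0 (hc 0).2
  have hy' := hyb (t 1) h1 (hc 1).2
  have hz' := hzb (t 2) h2 (hc 2).2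
  have hw' := hwb (t 3) (hc 3).1 (hc 3).2
  rw [abs_mul, abs_mul, abs_mul]
  exact mul_le_mul (mul_le_mul (mul_le_mul hx' hy' (abs_nonneg _) (by positivity)) hz'
    (abs_nonneg _) (by positivity)) hw' (abs_nonneg _) (by positivity)

/-! ## The registered sub-goal -/

/-- **Stub (existence of the word carriers of dimension four; registered sub-goal
`m4_exists_wordRep4` of stmt-KontsevichZagierPeriods-3869, line `SketchIdeator1`, layer `M4`
toolkit).** For letters `x ∈ {a, c}`, `y, z ∈ {a, b, c}`, `w ∈ {b, c}` (`a u = 1/u`,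
`b u = 1/(1−u)`, `c u = 1/(1+u)`) the word representation `[Δ₄, x(t₀)·y(t₁)·z(t₂)·w(t₃)]` on the
decreasing open simplex `Δ₄ = {0 < t₃ < t₂ < t₁ < t₀ < 1}` — the absolutely convergent iterated
integral `∫_{1 > t₀ > t₁ > t₂ > t₃ > 0} x y z w` — exists as an integral representation of the
Kontsevich–Zagier calculus with literally this domain and integrand.
[cite: KontsevichZagier2001, §1.1] -/
theorem m4_exists_wordRep4 :
    ∀ (x y z w : ℝ → ℝ),
      x ∈ ({fun u => 1 / u, fun u => 1 / (1 + u)} : Set (ℝ → ℝ)) →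
      y ∈ ({fun u => 1 / u, fun u => 1 / (1 - u), fun u => 1 / (1 + u)} : Set (ℝ → ℝ)) →
      z ∈ ({fun u => 1 / u, fun u => 1 / (1 - u), fun u => 1 / (1 + u)} : Set (ℝ → ℝ)) →
      w ∈ ({fun u => 1 / (1 - u), fun u => 1 / (1 + u)} : Set (ℝ → ℝ)) →
      ∃ T : IntegralRep 4, T.domain = {t | 0 < t 3 ∧ t 3 < t 2 ∧ t 2 < t 1 ∧ t 1 < t 0 ∧ t 0 < 1} ∧
        T.integrand = fun t => x (t 0) * y (t 1) * z (t 2) * w (t 3) := by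
  intro x y z w hx hy hz hw
  obtain ⟨hxf, hxb⟩ := m4w_first hx
  obtain ⟨hyf, hyb⟩ := m4w_middle hy
  obtain ⟨hzf, hzb⟩ := m4w_middle hz
  obtain ⟨hwf, hwb⟩ := m4w_last hw
  refine m4s_exists_rep_of_abs_le ?_ ?_ m4w_integrableOn_dominator
    (m4w_abs_word_le hxb hyb hzb hwb)
  · exact (IsSemialgebraicFunOn.mul_holds (IsSemialgebraicFunOn.mul_holds
      (IsSemialgebraicFunOn.mul_holds (hxf 0).2 (hyf 1).2) (hzf 2).2) (hwf 3).2).congr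
      fun _ _ => rfl
  · exact (((hxf 0).1.mul (hyf 1).1).mul (hzf 2).1).mul (hwf 3).1

end Summit.KontsevichZagierPeriods.HurwitzMicroSectors.NormalFormPrinciple.PiBox.M3
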